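import Summits.ValiantsHypothesis.ValiantsHypothesis.Theorems.BarrierLeverAnchoredDoorHitsLowerPairsRelApexLemma
import Summits.ValiantsHypothesis.ValiantsHypothesis.Theorems.BarrierLeverAnchoredDoorHitsLowerPairsApexRecursion

/-!
# Support item `AnchoredDoorHitsLowerPairs` (stmt-ValiantsHypothesis-22510), line `anchored-peeling`:
# THE RELATIVE APEX RECURSION — relative, typed apex-decomposable pairs `(R, F)` carry independent door columns; the narrowed residual

Helper file (`--supports stmt-ValiantsHypothesis-22510`; cell valiant-natproofs, rung V4, 𝒟-side door (c); registered line
`Cruxes/AnchoredDoorHitsLowerPairs/Lines/anchored_peeling.lean` v17/v18, registered residual `Stmt.stub_apexRest`; prover seat val-np-p1 gen 22;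
memo HOME/val-np-p1/g22/MEMO-relapex-valnp1-g22.md). Closes NO item.

GENERIC PACKAGING (§1–§2; as in `…ApexRecursion` with a row family `R` in place of `2^X`). For a SQUARE pair (`|R| = |F|`) `IndepColsR R F θ φ` is
non-vanishing of the door determinant (`indepColsR_iff_det_ne_zero`), hence generic simultaneity (`exists_indepColsR_and`); truncation `indepColsR_trunc_iff`.

THE RECURSION (§3). `RelApexDecomp R F` (inductive): `(∅, ∅)`, `({∅}, {∅})`, and `(R, F)` whenever a typed apex step (apex `v⋆ ↦ x_n`, tail set `G₁`,
root set `G₂`, lifted columns `T` with chosen labels `λ`; hypotheses of `indepColsR_apexT`) has both halves `(delFam R n, delFam F v⋆ ∖ T)` and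
`(linkFam R n, linkFam F v⋆ ∪ λ(T))` decomposable. **THEOREM `exists_indepColsR_of_relApexDecomp`: every relatively apex-decomposable pair has
independent door columns for some doors**; `RelApexDecomp.card_eq` (`|R| = |F|`); `relApexDecomp_powerset_of_apexDecomp` (the cube-row recursion
`ApexDecomp X F` of `…ApexRecursion` is the special case `R = 2^X`, `G₂ = ∅`, `λ = id`).

CONSEQUENCES (§4–§5). `symbolicDet_one_ne_zero_of_relApexDecomp` (relative apex pairs are hit at profile 1 — rows need NOT be a cube), `IsRelApexPair`
(⊇ `IsApexPair`: `isRelApexPair_of_isApexPair`); the NARROWED residual `Stmt.stub_relApexRest` (face-UQ residual minus relative apex pairs either way) with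
`stub_apexRest_of_relApexRest : Stmt.stub_relApexRest → Stmt.stub_apexRest` and `anchoredDoorHitsLowerPairs_of_relApexRest` (route decl BY NAME).

WHAT THIS IS NOT: `Stmt.stub_relApexRest` is OPEN and NOT census-empty (deep-versus-wide pairs exist at every size for every fixed profile,
memo §3); nothing on crux stmt-ValiantsHypothesis-14610 or on `VP` versus `VNP`.
-/

set_option linter.dupNamespace false

namespace Summit.ValiantsHypothesis.ValiantsHypothesis.Theorems.BarrierLever.AnchoredPeeling

open Finset MvPolynomial
open Summit.ValiantsHypothesis.ValiantsHypothesis.Theorems.BarrierLever.BrickCalculus (pexpo pexpo_def pexpo_le_iff pexpo_sub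
  pexpo_apply_castAdd pexpo_apply_natAdd)

noncomputable section

variable {h : ℕ}

/-! ## 1. Square pairs: relative independence is a determinant, hence generic -/

section Det

variable (R F : Finset (Finset (Fin h)))

/-- The door matrix of the pair `(R, F)`, columns enumerated by `e`. -/
def doorMatR (e : ↥R ≃ ↥F) (θ : Fin h → Fin h → ℂ) (φ : Fin h → Fin h → Fin h → ℂ) : Matrix ↥R ↥R ℂ :=
  Matrix.of fun U V => coeff (pexpo U.1 ∅) (∏ γ ∈ (e V).1, doorElem θ φ γ)

/-- Its symbolic version. -/
def doorMatRS (e : ↥R ≃ ↥F) : Matrix ↥R ↥R (MvPolynomial (DoorParam h) ℂ) :=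
  Matrix.of fun U V => coeff (pexpo U.1 ∅) (∏ γ ∈ (e V).1, doorElemS γ)

variable {R F}

/-- The symbolic determinant evaluates to the determinant. -/
theorem eval_det_doorMatRS (e : ↥R ≃ ↥F) (p : DoorParam h → ℂ) :
    eval p (doorMatRS R F e).det = (doorMatR R F e (thetaOf p) (phiOf p)).det := by
  rw [RingHom.map_det]
  congr 1
  ext U V
  rw [RingHom.mapMatrix_apply, Matrix.map_apply, doorMatRS, doorMatR, Matrix.of_apply, Matrix.of_apply, ← coeff_map, map_eval_prod_doorElemS]

/-- **For a square pair, relative column independence is nonvanishing of the door determinant.** -/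
theorem indepColsR_iff_det_ne_zero (e : ↥R ≃ ↥F) (θ : Fin h → Fin h → ℂ) (φ : Fin h → Fin h → Fin h → ℂ) :
    IndepColsR R F θ φ ↔ (doorMatR R F e θ φ).det ≠ 0 := by
  classical
  constructor
  · intro hind hdet
    obtain ⟨v, hv, hMv⟩ := Matrix.exists_mulVec_eq_zero_iff.mpr hdet
    apply hv
    set g : Finset (Fin h) → ℂ := fun W => if hW : W ∈ F then v (e.symm ⟨W, hW⟩) else 0 with hg
    have hcomb : ∀ U ∈ R, ∑ W ∈ F, g W * coeff (pexpo U ∅) (∏ γ ∈ W, doorElem θ φ γ) = 0 := by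
      intro U hU
      have hrow := congrFun hMv ⟨U, hU⟩
      rw [Pi.zero_apply, Matrix.mulVec, dotProduct] at hrow
      rw [← Finset.sum_coe_sort F, ← hrow, ← e.sum_comp]
      refine Finset.sum_congr rfl (fun V _ => ?_)
      rw [doorMatR, Matrix.of_apply, hg]
      simp only [Finset.coe_mem, dite_true, Subtype.coe_eta, Equiv.symm_apply_apply]
      ring
    funext V
    have := hind g hcomb (e V).1 (e V).2
    rw [hg] at this
    simp only [Finset.coe_mem, dite_true, Subtype.coe_eta, Equiv.symm_apply_apply] at this
    exact this
  · intro hdet g hg W hW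
    set v : ↥R → ℂ := fun V => g (e V).1 with hv
    have hMv : (doorMatR R F e θ φ).mulVec v = 0 := by
      funext U
      rw [Pi.zero_apply, Matrix.mulVec, dotProduct]
      have := hg U.1 U.2
      rw [← Finset.sum_coe_sort F, ← e.sum_comp] at this
      rw [← this]
      refine Finset.sum_congr rfl (fun V _ => ?_)
      rw [doorMatR, Matrix.of_apply, hv, mul_comm]
    have hv0 : v = 0 := by
      by_contra hne
      exact hdet (Matrix.exists_mulVec_eq_zero_iff.mp ⟨v, hne, hMv⟩)
    have := congrFun hv0 (e.symm ⟨W, hW⟩)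
    simp only [hv, Pi.zero_apply, Equiv.apply_symm_apply] at this
    exact this

/-- A square pair has a column enumeration by the rows. -/
theorem exists_equiv_of_card_eq (hcard : R.card = F.card) : Nonempty (↥R ≃ ↥F) := by
  refine ⟨Fintype.equivOfCardEq ?_⟩
  rw [Fintype.card_coe, Fintype.card_coe, hcard]

/-- **Generic simultaneity.** Two square pairs that are each independent for some doors are independent for common doors. -/
theorem exists_indepColsR_and {R₀ F₀ R₁ F₁ : Finset (Finset (Fin h))} (h0c : R₀.card = F₀.card) (h1c : R₁.card = F₁.card)
    (h0 : ∃ θ φ, IndepColsR R₀ F₀ θ φ) (h1 : ∃ θ φ, IndepColsR R₁ F₁ θ φ) :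
    ∃ (θ : Fin h → Fin h → ℂ) (φ : Fin h → Fin h → Fin h → ℂ), IndepColsR R₀ F₀ θ φ ∧ IndepColsR R₁ F₁ θ φ := by
  obtain ⟨e₀⟩ := exists_equiv_of_card_eq h0c
  obtain ⟨e₁⟩ := exists_equiv_of_card_eq h1c
  obtain ⟨θ₀, φ₀, hI₀⟩ := h0
  obtain ⟨θ₁, φ₁, hI₁⟩ := h1
  have hQ₀ : (doorMatRS R₀ F₀ e₀).det ≠ 0 := by
    intro h0
    apply (indepColsR_iff_det_ne_zero e₀ θ₀ φ₀).mp hI₀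
    have h' := eval_det_doorMatRS e₀ (pointOf θ₀ φ₀)
    rw [thetaOf_pointOf, phiOf_pointOf, h0, map_zero] at h'
    exact h'.symm
  have hQ₁ : (doorMatRS R₁ F₁ e₁).det ≠ 0 := by
    intro h0
    apply (indepColsR_iff_det_ne_zero e₁ θ₁ φ₁).mp hI₁
    have h' := eval_det_doorMatRS e₁ (pointOf θ₁ φ₁)
    rw [thetaOf_pointOf, phiOf_pointOf, h0, map_zero] at h'
    exact h'.symm
  have hprod : (doorMatRS R₀ F₀ e₀).det * (doorMatRS R₁ F₁ e₁).det ≠ 0 := mul_ne_zero hQ₀ hQ₁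
  have hpt : ∃ p : DoorParam h → ℂ, eval p ((doorMatRS R₀ F₀ e₀).det * (doorMatRS R₁ F₁ e₁).det) ≠ 0 := by
    by_contra hall
    exact hprod (MvPolynomial.funext (fun p => by rw [map_zero]; exact not_not.mp (fun hne => hall ⟨p, hne⟩)))
  obtain ⟨p, hp⟩ := hpt
  rw [map_mul] at hp
  refine ⟨thetaOf p, phiOf p, ?_, ?_⟩
  · exact (indepColsR_iff_det_ne_zero e₀ _ _).mpr (by rw [← eval_det_doorMatRS]; exact left_ne_zero_of_mul hp)
  · exact (indepColsR_iff_det_ne_zero e₁ _ _).mpr (by rw [← eval_det_doorMatRS]; exact right_ne_zero_of_mul hp)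

end Det

/-! ## 2. Truncation at the new variable -/

/-- **Rows avoiding `n` do not see the parameters at `n`.** -/
theorem indepColsR_trunc_iff {n : Fin h} (R' F : Finset (Finset (Fin h))) (hR' : ∀ U ∈ R', n ∉ U) (θ : Fin h → Fin h → ℂ)
    (φ : Fin h → Fin h → Fin h → ℂ) : IndepColsR R' F (truncTheta n θ) (truncPhi n φ) ↔ IndepColsR R' F θ φ := by
  classical
  have hentry : ∀ U ∈ R', ∀ W : Finset (Fin h),
      coeff (pexpo U ∅) (∏ γ ∈ W, doorElem (truncTheta n θ) (truncPhi n φ) γ) = coeff (pexpo U ∅) (∏ γ ∈ W, doorElem θ φ γ) := by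
    intro U hU W
    have hkill : (∏ γ ∈ W, doorElem (truncTheta n θ) (truncPhi n φ) γ) = ThinStep.killVars {Fin.castAdd h n} (∏ γ ∈ W, doorElem θ φ γ) := by
      rw [map_prod]; exact Finset.prod_congr rfl (fun γ _ => (killVars_doorElem n θ φ γ).symm)
    rw [hkill, ThinStep.coeff_killVars_of_disjoint]
    rw [Finset.disjoint_singleton_right, castAdd_mem_support_pexpo_iff]
    exact hR' U hU
  constructor <;> intro hI g hg
  · exact hI g (fun U hU => by rw [Finset.sum_congr rfl (fun W _ => by rw [hentry U hU W])]; exact hg U hU)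
  · exact hI g (fun U hU => by rw [Finset.sum_congr rfl (fun W _ => by rw [← hentry U hU W])]; exact hg U hU)

/-! ## 3. Relatively apex-decomposable pairs and the main theorem -/

/-- **Relatively apex-decomposable pairs** `(R, F)`: `(∅, ∅)`, `({∅}, {∅})`, or split by a typed apex step (hypotheses of `indepColsR_apexT`). -/
inductive RelApexDecomp : Finset (Finset (Fin h)) → Finset (Finset (Fin h)) → Prop
  | nil : RelApexDecomp ∅ ∅
  | unit : RelApexDecomp {∅} {∅}
  | step {n vs : Fin h} {R F T : Finset (Finset (Fin h))} {G₁ G₂ : Finset (Fin h)} {lam : Finset (Fin h) → Finset (Fin h)}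
      (hTF : T ⊆ delFam F vs)
      (hsupp : ∀ Y ∈ delFam F vs, labelsT G₁ G₂ Y ⊆ linkFam F vs ∪ T.image lam)
      (hown : ∀ Y₀ ∈ T, ∀ Y ∈ delFam F vs, lam Y₀ ∈ labelsT G₁ G₂ Y → Y = Y₀)
      (hlamL : ∀ Y₀ ∈ T, lam Y₀ ∉ linkFam F vs)
      (hlamT : ∀ Y₀ ∈ T, lam Y₀ ∈ labelsT G₁ G₂ Y₀)
      (h0 : RelApexDecomp (delFam R n) (delFam F vs \ T))
      (h1 : RelApexDecomp (linkFam R n) (linkFam F vs ∪ T.image lam)) :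
      RelApexDecomp R F

/-- A family splits into its deletion and link families (cardinalities). -/
theorem card_delFam_add_card_linkFam (F : Finset (Finset (Fin h))) (v : Fin h) : (delFam F v).card + (linkFam F v).card = F.card := by
  classical
  have hinj : Set.InjOn (fun W : Finset (Fin h) => W.erase v) ↑(F.filter (fun W => v ∈ W)) := fun W hW W' hW' heq =>
    Finset.erase_injOn' v (Finset.mem_filter.mp (Finset.mem_coe.mp hW)).2 (Finset.mem_filter.mp (Finset.mem_coe.mp hW')).2 heq
  have hsplit := Finset.card_filter_add_card_filter_not (s := F) (fun W => v ∉ W)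
  rw [linkFam, Finset.card_image_of_injOn hinj, delFam, ← hsplit]
  congr 1
  exact congrArg Finset.card (Finset.filter_congr (fun W _ => by rw [not_not]))

/-- The chosen labels are injective on the lifted columns. -/
theorem injOn_lam_of_own {F T : Finset (Finset (Fin h))} {vs : Fin h} {G₁ G₂ : Finset (Fin h)} {lam : Finset (Fin h) → Finset (Fin h)}
    (hTF : T ⊆ delFam F vs) (hown : ∀ Y₀ ∈ T, ∀ Y ∈ delFam F vs, lam Y₀ ∈ labelsT G₁ G₂ Y → Y = Y₀)
    (hlamT : ∀ Y₀ ∈ T, lam Y₀ ∈ labelsT G₁ G₂ Y₀) : Set.InjOn lam ↑T := by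
  intro Y₀ hY₀ Y₁ hY₁ heq
  have h' : lam Y₀ ∈ labelsT G₁ G₂ Y₁ := by rw [heq]; exact hlamT Y₁ hY₁
  exact (hown Y₀ hY₀ Y₁ (hTF hY₁) h').symm

/-- **Relatively apex-decomposable pairs are square.** -/
theorem RelApexDecomp.card_eq {R F : Finset (Finset (Fin h))} (hRF : RelApexDecomp R F) : R.card = F.card := by
  classical
  induction hRF with
  | nil => rfl
  | unit => rfl
  | @step n vs R F T G₁ G₂ lam hTF hsupp hown hlamL hlamT h0 h1 ih0 ih1 =>
    rw [← card_delFam_add_card_linkFam R n, ← card_delFam_add_card_linkFam F vs, ih0, ih1]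
    have hdisj : Disjoint (linkFam F vs) (T.image lam) := by
      rw [Finset.disjoint_right]
      intro μ hμ hμL
      obtain ⟨Y₀, hY₀, rfl⟩ := Finset.mem_image.mp hμ
      exact hlamL Y₀ hY₀ hμL
    rw [Finset.card_sdiff_of_subset hTF, Finset.card_union_of_disjoint hdisj,
      Finset.card_image_of_injOn (injOn_lam_of_own hTF hown hlamT)]
    have := Finset.card_le_card hTF
    omega

/-- **MAIN THEOREM: relatively apex-decomposable pairs have independent door columns for some doors.** -/
theorem exists_indepColsR_of_relApexDecomp {R F : Finset (Finset (Fin h))} (hRF : RelApexDecomp R F) :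
    ∃ (θ : Fin h → Fin h → ℂ) (φ : Fin h → Fin h → Fin h → ℂ), IndepColsR R F θ φ := by
  classical
  induction hRF with
  | nil => exact ⟨fun _ _ => 0, fun _ _ _ => 0, fun g _ W hW => absurd hW (Finset.notMem_empty W)⟩
  | unit =>
    refine ⟨fun _ _ => 0, fun _ _ _ => 0, fun g hg W hW => ?_⟩
    rw [Finset.mem_singleton] at hW
    subst hW
    have := hg ∅ (Finset.mem_singleton_self ∅)
    rw [Finset.sum_singleton, Finset.prod_empty, MvPolynomial.coeff_one, if_pos (by simp [pexpo_def]), mul_one] at this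
    exact this
  | @step n vs R F T G₁ G₂ lam hTF hsupp hown hlamL hlamT h0 h1 ih0 ih1 =>
    obtain ⟨θ, φ, hI0, hI1⟩ := exists_indepColsR_and h0.card_eq h1.card_eq ih0 ih1
    refine ⟨apexThetaT (truncTheta n θ) vs n G₂, apexPhiT (truncPhi n φ) vs n G₁, ?_⟩
    refine indepColsR_apexT R F T G₁ G₂ lam hTF hsupp hown hlamL hlamT (fun γ => by simp [truncTheta]) (fun b γ => by simp [truncPhi]) ?_ ?_
    · exact (indepColsR_trunc_iff _ _ (fun U hU => (mem_delFam.mp hU).2) θ φ).mpr hI0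
    · exact (indepColsR_trunc_iff _ _ (fun U hU => (mem_linkFam.mp hU).1) θ φ).mpr hI1

/-- The deletion family of the cube `2^{X' ⊔ n}` at `n` is the cube `2^{X'}`. -/
theorem delFam_powerset_insert {X' : Finset (Fin h)} {n : Fin h} (hn : n ∉ X') : delFam (insert n X').powerset n = X'.powerset := by
  classical
  ext U
  rw [mem_delFam, Finset.mem_powerset, Finset.mem_powerset]
  constructor
  · rintro ⟨hU, hnU⟩
    intro x hx
    rcases Finset.mem_insert.mp (hU hx) with rfl | h'
    · exact absurd hx hnU
    · exact h'
  · intro hU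
    exact ⟨hU.trans (Finset.subset_insert n X'), fun hnU => hn (hU hnU)⟩

/-- The link family of the cube `2^{X' ⊔ n}` at `n` is the cube `2^{X'}`. -/
theorem linkFam_powerset_insert {X' : Finset (Fin h)} {n : Fin h} (hn : n ∉ X') : linkFam (insert n X').powerset n = X'.powerset := by
  classical
  ext V
  rw [mem_linkFam, Finset.mem_powerset, Finset.mem_powerset]
  constructor
  · rintro ⟨hnV, hins⟩
    intro x hx
    rcases Finset.mem_insert.mp (hins (Finset.mem_insert_of_mem hx)) with rfl | h'
    · exact absurd hx hnV
    · exact h'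
  · intro hV
    exact ⟨fun hnV => hn (hV hnV), Finset.insert_subset_insert n hV⟩

/-- With no ROOT vertices the labels of `Y` are `{Y}` if `Y` meets the tail set, and none otherwise. -/
theorem mem_labelsT_empty {G₁ Y μ : Finset (Fin h)} : μ ∈ labelsT G₁ ∅ Y ↔ μ = Y ∧ (Y ∩ G₁).Nonempty := by
  rw [mem_labelsT, Finset.inter_empty]
  constructor
  · rintro (h' | ⟨γ, hγ, -⟩)
    · exact h'
    · exact absurd hγ (Finset.notMem_empty γ)
  · exact fun h' => Or.inl h'

/-- **The cube-row recursion is a special case:** `ApexDecomp X F → RelApexDecomp (2^X) F` (Move A = no root vertices, labels `λ = id`). -/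
theorem relApexDecomp_powerset_of_apexDecomp {X : Finset (Fin h)} {F : Finset (Finset (Fin h))} (hF : ApexDecomp X F) :
    RelApexDecomp X.powerset F := by
  classical
  induction hF with
  | base => rw [Finset.powerset_empty]; exact RelApexDecomp.unit
  | @step X' n vs F G₁ T hn hTF hTG hTL hcov h0 h1 ih0 ih1 =>
    have hTG' : ∀ Y ∈ T, (Y ∩ G₁).Nonempty := fun Y hY => (sum_tailInd_ne_zero_iff Y).mp (hTG Y hY)
    refine RelApexDecomp.step (n := n) (vs := vs) (T := T) (G₁ := G₁) (G₂ := ∅) (lam := id) ?_ ?_ ?_ ?_ ?_ ?_ ?_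
    · exact fun Y hY => mem_delFam.mpr (hTF Y hY)
    · intro Y hY μ hμ
      obtain ⟨rfl, hne⟩ := mem_labelsT_empty.mp hμ
      obtain ⟨hYF, hvsY⟩ := mem_delFam.mp hY
      rcases hcov μ hYF hvsY ((sum_tailInd_ne_zero_iff μ).mpr hne) with h' | h'
      · exact Finset.mem_union_right _ (by rw [Finset.image_id]; exact h')
      · exact Finset.mem_union_left _ (mem_linkFam.mpr ⟨hvsY, h'⟩)
    · intro Y₀ _ Y _ hμ
      exact ((mem_labelsT_empty.mp hμ).1).symm
    · intro Y₀ hY₀ hL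
      exact hTL Y₀ hY₀ (mem_linkFam.mp hL).2
    · intro Y₀ hY₀
      exact mem_labelsT_empty.mpr ⟨rfl, hTG' Y₀ hY₀⟩
    · rw [delFam_powerset_insert hn]
      exact ih0
    · rw [linkFam_powerset_insert hn, Finset.image_id]
      exact ih1

/-! ## 4. The profile-1 hit and relative apex pairs -/

/-- **Independent columns ⟹ nonzero door determinant on any square layout** whose rows exhaust `R` and whose columns are drawn injectively from `F`. -/
theorem det_ne_zero_of_indepColsR {R F : Finset (Finset (Fin h))} {θ : Fin h → Fin h → ℂ} {φ : Fin h → Fin h → Fin h → ℂ}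
    (hI : IndepColsR R F θ φ) {r : ℕ} (u w : Fin r → Finset (Fin h)) (hu : ∀ U ∈ R, ∃ i, u i = U) (hw : Function.Injective w)
    (hwF : ∀ j, w j ∈ F) :
    (Matrix.of fun i j : Fin r => coeff (pexpo (u i) ∅) (∏ γ ∈ w j, doorElem θ φ γ)).det ≠ 0 := by
  classical
  intro hdet
  obtain ⟨v, hv, hMv⟩ := Matrix.exists_mulVec_eq_zero_iff.mpr hdet
  apply hv
  set g : Finset (Fin h) → ℂ := fun W => if hW : ∃ j, w j = W then v hW.choose else 0 with hg
  have hgw : ∀ j, g (w j) = v j := by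
    intro j
    have hex : ∃ j', w j' = w j := ⟨j, rfl⟩
    rw [hg]; simp only [dif_pos hex]
    exact congrArg v (hw hex.choose_spec)
  have hcomb : ∀ U ∈ R, ∑ W ∈ F, g W * coeff (pexpo U ∅) (∏ γ ∈ W, doorElem θ φ γ) = 0 := by
    intro U hU
    obtain ⟨i, rfl⟩ := hu U hU
    have hrow := congrFun hMv i
    rw [Pi.zero_apply, Matrix.mulVec, dotProduct] at hrow
    have hzero : ∀ W ∈ F, W ∉ Finset.univ.image w → g W * coeff (pexpo (u i) ∅) (∏ γ ∈ W, doorElem θ φ γ) = 0 := by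
      intro W _ hW
      have hne : ¬ ∃ j, w j = W := fun ⟨j, hj⟩ => hW (Finset.mem_image.mpr ⟨j, Finset.mem_univ j, hj⟩)
      rw [hg]; simp only [dif_neg hne, zero_mul]
    rw [← Finset.sum_subset (fun W hW => by obtain ⟨j, -, rfl⟩ := Finset.mem_image.mp hW; exact hwF j) hzero,
      Finset.sum_image (fun j _ j' _ hjj => hw hjj), ← hrow]
    refine Finset.sum_congr rfl (fun j _ => ?_)
    rw [hgw, Matrix.of_apply, mul_comm]
  funext j
  rw [Pi.zero_apply, ← hgw]
  exact hI g hcomb (w j) (hwF j)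

/-- **A pair whose row family and column family are relatively apex-decomposable is hit at profile 1** (the `ψ = 0` member). -/
theorem symbolicDet_one_ne_zero_of_relApexDecomp {r : ℕ} (u w : Fin r → Finset (Fin h)) (hw : Function.Injective w)
    (hF : RelApexDecomp (Finset.univ.image u) (Finset.univ.image w)) : symbolicDet 1 h r u w ≠ 0 := by
  classical
  obtain ⟨θ, φ, hI⟩ := exists_indepColsR_of_relApexDecomp hF
  have hdet := det_ne_zero_of_indepColsR hI u w
    (fun U hU => by obtain ⟨i, -, hi⟩ := Finset.mem_image.mp hU; exact ⟨i, hi⟩) hw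
    (fun j => Finset.mem_image.mpr ⟨j, Finset.mem_univ j, rfl⟩)
  intro h0
  have hmap := congrArg (eval (mPoint θ φ)) h0
  rw [map_zero, symbolicDet, RingHom.map_det] at hmap
  apply hdet
  rw [← hmap]
  congr 1
  refine Matrix.ext (fun i j => ?_)
  rw [RingHom.mapMatrix_apply, Matrix.map_apply, Matrix.of_apply, Matrix.of_apply, ← pexpo_def, ← coeff_map, map_mPoint_symbolicWitness,
    coeff_prod_cpart θ φ Finset.univ (u i) (w j) (Finset.subset_univ _)]

/-- A pair is a **relative apex pair** if its (row family, column family) is relatively apex-decomposable. -/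
def IsRelApexPair {r : ℕ} (u w : Fin r → Finset (Fin h)) : Prop :=
  RelApexDecomp (Finset.univ.image u) (Finset.univ.image w)

/-- **Apex pairs are relative apex pairs** (with injective rows). -/
theorem isRelApexPair_of_isApexPair {r : ℕ} {u w : Fin r → Finset (Fin h)} (hu : Function.Injective u) (hw : Function.Injective w)
    (hP : IsApexPair u w) : IsRelApexPair u w := by
  classical
  obtain ⟨X, huX, hF⟩ := hP
  -- every subset of X is a row, and #rows = #columns = 2^|X|: the rows are exactly 2^X
  have hR : X.powerset = Finset.univ.image u := by
    apply Finset.eq_of_subset_of_card_le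
    · intro U hU
      obtain ⟨i, hi⟩ := huX U (Finset.mem_powerset.mp hU)
      exact Finset.mem_image.mpr ⟨i, Finset.mem_univ i, hi⟩
    · have h1 := Finset.card_image_of_injective Finset.univ hu
      have h2 := Finset.card_image_of_injective Finset.univ hw
      rw [Finset.card_powerset, ← hF.card_eq, h1, h2]
  rw [IsRelApexPair, ← hR]
  exact relApexDecomp_powerset_of_apexDecomp hF


/-! ## 5. The narrowed residual and the composition by name -/

/-- **STUB TEXT (offered): THE RELATIVE APEX REST.** At some fixed profile `s ≥ 1` and all `h ≥ h₀`: every injective simplicial-complex pair with `r ≥ 2`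
rows, NO face-UQ data on either side, which is not a RELATIVE apex pair in either orientation, has nonzero symbolic minor. (NOT census-empty: memo §3.) -/
def Stmt.stub_relApexRest : Prop :=
  ∃ s h₀ : ℕ, 1 ≤ s ∧ ∀ h : ℕ, h₀ ≤ h → ∀ (r : ℕ) (u w : Fin r → Finset (Fin h)),
    Function.Injective u → Function.Injective w → IsLowerSet (Set.range u) → IsLowerSet (Set.range w) → 2 ≤ r →
    (∀ (a : Fin h) (W₀ : Finset (Fin h)) (𝒜 : Finset (Finset (Fin h))) (ρ : Finset (Fin h) → Finset (Fin h)), ¬ UQFData s u w a W₀ 𝒜 ρ) →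
    (∀ (c : Fin h) (Z : Finset (Fin h)) (𝒜 : Finset (Finset (Fin h))) (ρ : Finset (Fin h) → Finset (Fin h)), ¬ UQFData s w u c Z 𝒜 ρ) →
    ¬ IsRelApexPair u w → ¬ IsRelApexPair w u →
    symbolicDet s h r u w ≠ 0

/-- **Kernel narrowing of the registered residual: relative apex rest ⟹ `Stmt.stub_apexRest`.** -/
theorem stub_apexRest_of_relApexRest (hR : Stmt.stub_relApexRest) : Stmt.stub_apexRest := by
  obtain ⟨s, h₀, hs, hR⟩ := hR
  refine ⟨s, h₀, hs, fun h hh r u w hu hw hlu hlw hr hx hy _ _ => ?_⟩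
  by_cases hrx : IsRelApexPair u w
  · exact symbolicDet_ne_zero_mono hs (symbolicDet_one_ne_zero_of_relApexDecomp u w hw hrx)
  · by_cases hry : IsRelApexPair w u
    · exact (symbolicDet_ne_zero_comm s h r u w).mpr (symbolicDet_ne_zero_mono hs (symbolicDet_one_ne_zero_of_relApexDecomp w u hu hry))
    · exact hR h hh r u w hu hw hlu hlw hr hx hy hrx hry

/-- **Composition BY NAME: relative apex rest ⟹ the support item `AnchoredDoorHitsLowerPairs`** (through `anchoredDoorHitsLowerPairs_of_apexRest`). -/
theorem anchoredDoorHitsLowerPairs_of_relApexRest (hR : Stmt.stub_relApexRest) :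
    Summit.ValiantsHypothesis.ValiantsHypothesis.Theses.BarrierLever.AnchoredDoorHitsLowerPairs :=
  anchoredDoorHitsLowerPairs_of_apexRest (stub_apexRest_of_relApexRest hR)

end

end Summit.ValiantsHypothesis.ValiantsHypothesis.Theorems.BarrierLever.AnchoredPeeling
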